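import Summits.CriticalPhenomena.PercolationContinuityZ3.Theorems.PercNearOneGluingNoHeavyQuantSubfloorPairHub
import HarnessLib

/-!
# QUANT lane R8, T-DEC: SUB-FLOOR HUBS (part 2, the TRIPLE HUB) — three far-giant pieces `{1,3;γᵢ}` convolved are SDEC at the true floor although
# each one alone violates the FAR row (the cores of the piece expansion of the node's residue: three glued children `R[qᵢ](R²[gᵢ])`)

builds on p205010 (kernel theorem, internal audit signed; external expert review pending)

Support file (`--supports stmt-CriticalPhenomena-4575`), QUANT lane seat prim-quant-census-1 (gen 30); memo
`run/shared/lean/prim/quant/prim-quant-census-1/g30/SUBFLOOR-HUBS-G30.md`.  Theorems only (standard axioms, no sorries) over the lane's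
flow criteria: arm-1 g49's `decAt_all_of_budget_near` / `decAt_all_of_lowCeiling` (`…QuantBudgetNearFlow`, `…QuantLowCeiling`).

THE SETTING (RATE-PLAN §58.4).  After COMP-SLICE (✓ p547225) and HIGH-CONV (✓ p548056) the sibling step `SiblingStep` owes only forests ALL of
whose siblings are heavy-unfloored; the smallest such sibling is the glued child `R[q](R²[g])` of mean `m = q(1+2g) > 2` at floors
`(m−1)/2 < x < qg`, whose gated law `(1−q, q(1−g), 0, qg)` is the (forced) same-mean mixture of the heavy blob `blob₃(m/3)` and the FAR-GIANT
PIECE `C(γ) = {1,3;γ}`, `γ = (m−1)/2 < x` (a sure relay over an UNDER-floor 2-blob; not SDEC at `x`: the FAR row `P(N ≥ 3) = γ < x` fails).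
Expanding a forest of glued children over the per-sibling choices gives terms `C_S ∗ blob_{Sᶜ}`; the heavy blobs peel off
(`sdec_lconv_blobLaw`), so the new cores are the SUB-FLOOR HUBS `∗_{i∈S} C(γᵢ)` = `|S|` sure relays ⊕ `|S|` independent under-floor 2-blobs.
This file proves that the pair hub and the triple hub ARE SDEC at `x` on the whole closure of the glued-child parameter region
(`1/2 ≤ γᵢ < 1`, `3x ≤ 1 + 2γᵢ`; for a glued child `1 + 2γᵢ = mᵢ` and `x ≤ qᵢgᵢ ≤ mᵢ/3`):
* **`sdec_pairHub`**: `C(γ₁) ∗ C(γ₂) = {2: (1−γ₁)(1−γ₂), 4: γ₁(1−γ₂)+(1−γ₁)γ₂, 6: γ₁γ₂}` is `SDEC x 6`.  Certificate: after the outer gate `a`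
  the only positive low atom is `2` (when `T = a(2+2γ₁+2γ₂) > 4`), shipped by ONE NEAR ROUTE `2 → 4` ("one more blob on") at the layer-free rate
  `max(ax, (T−4)/2)/(1 − max(…))`; capacity ⟸ `x·(e₀+e₁) ≤ e₁` (termwise from `3x ≤ 1+2γᵢ`, `γᵢ ≥ 1/2`) and `(γ₁+γ₂−1)(e₀+e₁) ≤ e₁`
  (`= (1−γ₁)(1−γ₂)(1+γ₁+γ₂) + (γ₁−γ₂)² ≥ 0`); the zero atom rides the torque (`decAt_all_of_budget_near` with no leftover).
* **`sdec_tripleHub`**: `C(γ₁) ∗ C(γ₂) ∗ C(γ₃)` on `{3,5,7,9}` is `SDEC x 9`: the only positive low `3` (when `T > 6`) goes to `5` while `T < 7`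
  and to `7` when `T ≥ 7` (both near routes); capacities ⟸ `x(e₀+e₁) ≤ e₁`, `e₀ ≤ e₁`, `x(e₀+e₂) ≤ e₂`, `3e₀ ≤ e₂` (termwise).
EVIDENCE BEHIND THE SHAPE (memo §2–§4, exact rational LPs): for relay ⊕ independent-blob hubs SDEC ⟺ the FAR rows of the UNGATED hub
(`P(N ≥ j+1) ≥ x` for `2j < mean`) ⟺ arm-1 g50's layer-free torque-cost LP is feasible at every gate — 0 exceptions in ≈ 10 000 hubs incl. ≈ 800
non-SDEC ones (conjecture HUB-FAR of the memo; false for general laws, e.g. census-2 g53's `{1:36/73, 2:1/73, 6:36/73}`).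

HONEST STATUS.  Two cores of the width-3 glued-children instance; the third core (`C(γ) ∗ blob₃(g')`, one far-giant piece beside a big heavy blob)
and the assembly are owed (memo §5).  `SiblingStep` ⟺ `GateStepN`, `FarTreeRow` OPEN; RATE class (log\*) / honest sentence of
`run/shared/lean/prim/quant/README.md` unchanged.  [this work].  Nothing here is cited as a published result.  The gluing rows served
[cite: KozmaNitzan2024, Conjecture 3 (p. 15)]; product measure [cite: Grimmett1999, §1.3 p. 10].
-/

noncomputable section

open scoped BigOperators

namespace Summit.CriticalPhenomena.PercolationContinuityZ3.Theorems
namespace Quant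
namespace LawDec

open Finset

/-- the FAR-GIANT PIECE `C(γ) = {1, 3; γ}`: one sure relay over an under-floor 2-blob at gate `γ` -/
local notation3 "CP[" a "]" => (fun h : ℕ => (1 - (a : ℝ)) * (if h = 1 then (1 : ℝ) else 0) + (a : ℝ) * (if h = 3 then (1 : ℝ) else 0))

/-- the PAIR HUB `C(γ₁) ∗ C(γ₂)`: two sure relays ⊕ two independent 2-blobs at gates `γ₁`, `γ₂` -/
local notation3 "PH[" a ", " b "]" => (fun h : ℕ =>
  (1 - (a : ℝ)) * (1 - (b : ℝ)) * (if h = 2 then (1 : ℝ) else 0) +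
  ((a : ℝ) * (1 - (b : ℝ)) + (1 - (a : ℝ)) * (b : ℝ)) * (if h = 4 then (1 : ℝ) else 0) +
  (a : ℝ) * (b : ℝ) * (if h = 6 then (1 : ℝ) else 0))

/-- the TRIPLE HUB `C(γ₁) ∗ C(γ₂) ∗ C(γ₃)`: three sure relays ⊕ three independent 2-blobs -/
local notation3 "TH[" a ", " b ", " c "]" => (fun h : ℕ =>
  (1 - (a : ℝ)) * (1 - (b : ℝ)) * (1 - (c : ℝ)) * (if h = 3 then (1 : ℝ) else 0) +
  ((a : ℝ) * (1 - (b : ℝ)) * (1 - (c : ℝ)) + (1 - (a : ℝ)) * (b : ℝ) * (1 - (c : ℝ)) + (1 - (a : ℝ)) * (1 - (b : ℝ)) * (c : ℝ)) *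
    (if h = 5 then (1 : ℝ) else 0) +
  ((a : ℝ) * (b : ℝ) * (1 - (c : ℝ)) + (a : ℝ) * (1 - (b : ℝ)) * (c : ℝ) + (1 - (a : ℝ)) * (b : ℝ) * (c : ℝ)) *
    (if h = 7 then (1 : ℝ) else 0) +
  (a : ℝ) * (b : ℝ) * (c : ℝ) * (if h = 9 then (1 : ℝ) else 0))

/-! ### The triple hub as a convolution -/

/-- the triple hub is the pair hub convolved with a third far-giant piece. [this work] -/
theorem tripleHub_eq_lconv (γ₁ γ₂ γ₃ : ℝ) : lconv 6 3 PH[γ₁, γ₂] CP[γ₃] = TH[γ₁, γ₂, γ₃] := by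
  funext h
  simp only [lconv, Finset.sum_range_succ, Finset.sum_range_zero]
  rcases Nat.lt_or_ge h 10 with hh | hh
  · interval_cases h
    all_goals norm_num
    all_goals ring
  · simp [show h ≠ 3 by omega, show h ≠ 5 by omega, show h ≠ 7 by omega, show h ≠ 9 by omega, show (3 : ℕ) ≠ h by omega,
      show (5 : ℕ) ≠ h by omega, show (7 : ℕ) ≠ h by omega, show (9 : ℕ) ≠ h by omega]

/-! ### The triple hub -/

/-- the per-blob inequality behind the triple hub: `3x ≤ 1 + 2γ`, `1/4 ≤ γ ≤ 1` ⟹ `x(1−γ) ≤ 3(1−x)γ`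
(`3γ − x(1+2γ) = (1+2γ)(1+2γ−3x)/3 + (4γ−1)(1−γ)/3`). [this work] -/
theorem tripleHub_blob_ineq {x γ : ℝ} (hγ : 1 / 4 ≤ γ) (hγ1 : γ ≤ 1) (hx : 3 * x ≤ 1 + 2 * γ) : x * (1 - γ) ≤ 3 * (1 - x) * γ := by
  nlinarith [mul_nonneg (show (0 : ℝ) ≤ 1 + 2 * γ by linarith) (show (0 : ℝ) ≤ 1 + 2 * γ - 3 * x by linarith),
    mul_nonneg (show (0 : ℝ) ≤ 4 * γ - 1 by linarith) (show (0 : ℝ) ≤ 1 - γ by linarith)]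

/-- the per-pair inequality behind the route `3 → 7`: `x(1−γ)(1−γ') ≤ 3(1−x)γγ'` (`γ' ≥ 1/2`). [this work] -/
theorem tripleHub_pair_ineq {x γ γ' : ℝ} (hγ : 1 / 4 ≤ γ) (hγ1 : γ ≤ 1) (hx : 3 * x ≤ 1 + 2 * γ)
    (hγ' : 1 / 2 ≤ γ') (_hγ'1 : γ' ≤ 1) : x * (1 - γ) * (1 - γ') ≤ 3 * (1 - x) * γ * γ' := by
  have t : 0 ≤ 3 * (1 - x) * γ - x * (1 - γ) := by linarith [tripleHub_blob_ineq hγ hγ1 hx]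
  nlinarith [mul_nonneg t (show (0 : ℝ) ≤ 1 - γ' by linarith),
    mul_nonneg (mul_nonneg (show (0 : ℝ) ≤ 1 - x by linarith) (show (0 : ℝ) ≤ γ by linarith)) (show (0 : ℝ) ≤ 2 * γ' - 1 by linarith)]

/-- capacity inequalities of the triple hub: with `e₀ = Π(1−γᵢ)`, `e₁ = Σᵢ γᵢ Π_{j≠i}(1−γⱼ)`, `e₂ = Σ_{i<j} γᵢγⱼ(1−γ_k)`:
`x(e₀+e₁) ≤ e₁`, `e₀ ≤ e₁`, `x(e₀+e₂) ≤ e₂`, `3e₀ ≤ e₂`. [this work] -/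
theorem tripleHub_keys {x γ₁ γ₂ γ₃ : ℝ} (h₁ : 1 / 2 ≤ γ₁) (h₁' : γ₁ ≤ 1) (h₂ : 1 / 2 ≤ γ₂) (h₂' : γ₂ ≤ 1)
    (h₃ : 1 / 2 ≤ γ₃) (h₃' : γ₃ ≤ 1) (hx₁ : 3 * x ≤ 1 + 2 * γ₁) (hx₂ : 3 * x ≤ 1 + 2 * γ₂) (hx₃ : 3 * x ≤ 1 + 2 * γ₃) :
    (x * ((1 - γ₁) * (1 - γ₂) * (1 - γ₃) + (γ₁ * (1 - γ₂) * (1 - γ₃) + (1 - γ₁) * γ₂ * (1 - γ₃) + (1 - γ₁) * (1 - γ₂) * γ₃))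
      ≤ γ₁ * (1 - γ₂) * (1 - γ₃) + (1 - γ₁) * γ₂ * (1 - γ₃) + (1 - γ₁) * (1 - γ₂) * γ₃) ∧
    ((1 - γ₁) * (1 - γ₂) * (1 - γ₃) ≤ γ₁ * (1 - γ₂) * (1 - γ₃) + (1 - γ₁) * γ₂ * (1 - γ₃) + (1 - γ₁) * (1 - γ₂) * γ₃) ∧
    (x * ((1 - γ₁) * (1 - γ₂) * (1 - γ₃) + (γ₁ * γ₂ * (1 - γ₃) + γ₁ * (1 - γ₂) * γ₃ + (1 - γ₁) * γ₂ * γ₃))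
      ≤ γ₁ * γ₂ * (1 - γ₃) + γ₁ * (1 - γ₂) * γ₃ + (1 - γ₁) * γ₂ * γ₃) ∧
    (3 * ((1 - γ₁) * (1 - γ₂) * (1 - γ₃)) ≤ γ₁ * γ₂ * (1 - γ₃) + γ₁ * (1 - γ₂) * γ₃ + (1 - γ₁) * γ₂ * γ₃) := by
  have n₁ : (0 : ℝ) ≤ 1 - γ₁ := by linarith
  have n₂ : (0 : ℝ) ≤ 1 - γ₂ := by linarith
  have n₃ : (0 : ℝ) ≤ 1 - γ₃ := by linarith
  have t₁ : 0 ≤ 3 * (1 - x) * γ₁ - x * (1 - γ₁) := by linarith [tripleHub_blob_ineq (by linarith) h₁' hx₁]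
  have t₂ : 0 ≤ 3 * (1 - x) * γ₂ - x * (1 - γ₂) := by linarith [tripleHub_blob_ineq (by linarith) h₂' hx₂]
  have t₃ : 0 ≤ 3 * (1 - x) * γ₃ - x * (1 - γ₃) := by linarith [tripleHub_blob_ineq (by linarith) h₃' hx₃]
  have u₁₂ : 0 ≤ 3 * (1 - x) * γ₁ * γ₂ - x * (1 - γ₁) * (1 - γ₂) := by
    linarith [tripleHub_pair_ineq (by linarith) h₁' hx₁ h₂ h₂']
  have u₁₃ : 0 ≤ 3 * (1 - x) * γ₁ * γ₃ - x * (1 - γ₁) * (1 - γ₃) := by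
    linarith [tripleHub_pair_ineq (by linarith) h₁' hx₁ h₃ h₃']
  have u₂₃ : 0 ≤ 3 * (1 - x) * γ₂ * γ₃ - x * (1 - γ₂) * (1 - γ₃) := by
    linarith [tripleHub_pair_ineq (by linarith) h₂' hx₂ h₃ h₃']
  have w₁₂ : 0 ≤ γ₁ * γ₂ - (1 - γ₁) * (1 - γ₂) := by nlinarith
  have w₁₃ : 0 ≤ γ₁ * γ₃ - (1 - γ₁) * (1 - γ₃) := by nlinarith
  have w₂₃ : 0 ≤ γ₂ * γ₃ - (1 - γ₂) * (1 - γ₃) := by nlinarith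
  refine ⟨?_, ?_, ?_, ?_⟩
  · nlinarith [mul_nonneg (mul_nonneg n₂ n₃) t₁, mul_nonneg (mul_nonneg n₁ n₃) t₂, mul_nonneg (mul_nonneg n₁ n₂) t₃]
  · nlinarith [mul_nonneg (mul_nonneg (show (0 : ℝ) ≤ 2 * γ₁ - 1 by linarith) n₂) n₃,
      mul_nonneg (mul_nonneg n₁ (show (0 : ℝ) ≤ γ₂ by linarith)) n₃, mul_nonneg (mul_nonneg n₁ n₂) (show (0 : ℝ) ≤ γ₃ by linarith)]
  · nlinarith [mul_nonneg n₃ u₁₂, mul_nonneg n₂ u₁₃, mul_nonneg n₁ u₂₃]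
  · nlinarith [mul_nonneg n₃ w₁₂, mul_nonneg n₂ w₁₃, mul_nonneg n₁ w₂₃]

/-- **THE TRIPLE HUB IS SDEC.**  For `0 < x < 1`, `1/2 ≤ γᵢ < 1`, `3x ≤ 1 + 2γᵢ` (`i = 1,2,3`): the law of `3 + 2·#{i : blob i on}` (three
far-giant pieces `{1,3;γᵢ}` convolved; atoms `3,5,7,9`) is `SDEC x 9`.  After the outer gate `a` the only positive low atom is `3` (when
`T = a(3 + 2Σγᵢ) > 6`); it is shipped by the near route `3 → 5` while `T < 7` and by `3 → 7` when `T ≥ 7`. [this work] -/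
theorem sdec_tripleHub {x γ₁ γ₂ γ₃ : ℝ} (hx0 : 0 < x) (hx1 : x < 1) (h₁ : 1 / 2 ≤ γ₁) (h₁' : γ₁ < 1) (h₂ : 1 / 2 ≤ γ₂) (h₂' : γ₂ < 1)
    (h₃ : 1 / 2 ≤ γ₃) (h₃' : γ₃ < 1) (hx₁ : 3 * x ≤ 1 + 2 * γ₁) (hx₂ : 3 * x ≤ 1 + 2 * γ₂) (hx₃ : 3 * x ≤ 1 + 2 * γ₃) :
    SDEC x 9 TH[γ₁, γ₂, γ₃] := by
  have n₁ : (0 : ℝ) ≤ 1 - γ₁ := by linarith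
  have n₂ : (0 : ℝ) ≤ 1 - γ₂ := by linarith
  have n₃ : (0 : ℝ) ≤ 1 - γ₃ := by linarith
  have p₁ : (0 : ℝ) ≤ γ₁ := by linarith
  have p₂ : (0 : ℝ) ≤ γ₂ := by linarith
  have p₃ : (0 : ℝ) ≤ γ₃ := by linarith
  have e0n : 0 ≤ (1 - γ₁) * (1 - γ₂) * (1 - γ₃) := mul_nonneg (mul_nonneg n₁ n₂) n₃
  have e1n : 0 ≤ γ₁ * (1 - γ₂) * (1 - γ₃) + (1 - γ₁) * γ₂ * (1 - γ₃) + (1 - γ₁) * (1 - γ₂) * γ₃ :=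
    add_nonneg (add_nonneg (mul_nonneg (mul_nonneg p₁ n₂) n₃) (mul_nonneg (mul_nonneg n₁ p₂) n₃)) (mul_nonneg (mul_nonneg n₁ n₂) p₃)
  have e2n : 0 ≤ γ₁ * γ₂ * (1 - γ₃) + γ₁ * (1 - γ₂) * γ₃ + (1 - γ₁) * γ₂ * γ₃ :=
    add_nonneg (add_nonneg (mul_nonneg (mul_nonneg p₁ p₂) n₃) (mul_nonneg (mul_nonneg p₁ n₂) p₃)) (mul_nonneg (mul_nonneg n₁ p₂) p₃)
  have e3n : 0 ≤ γ₁ * γ₂ * γ₃ := mul_nonneg (mul_nonneg p₁ p₂) p₃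
  -- law facts
  have l0 : ∀ h, 0 ≤ TH[γ₁, γ₂, γ₃] h := by
    intro h; dsimp only; split_ifs <;> linarith
  have lM : ∀ h, 9 < h → TH[γ₁, γ₂, γ₃] h = 0 := by
    intro h hh; dsimp only; rw [if_neg (by omega), if_neg (by omega), if_neg (by omega), if_neg (by omega)]; ring
  have l1 : ∑ h ∈ Finset.range (9 + 1), TH[γ₁, γ₂, γ₃] h = 1 := by
    simp [Finset.sum_range_succ]; ring
  have lmean : ∑ h ∈ Finset.range (9 + 1), (h : ℝ) * TH[γ₁, γ₂, γ₃] h = 3 + 2 * γ₁ + 2 * γ₂ + 2 * γ₃ := by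
    simp [Finset.sum_range_succ]; ring
  obtain ⟨key1, key2, key3, key4⟩ := tripleHub_keys h₁ h₁'.le h₂ h₂'.le h₃ h₃'.le hx₁ hx₂ hx₃
  have h9x : 9 * x ≤ 3 + 2 * γ₁ + 2 * γ₂ + 2 * γ₃ := by linarith
  intro a ha0 ha1 j' hj'
  obtain ⟨g0, gM, g1⟩ := gate_laws 9 TH[γ₁, γ₂, γ₃] a ha0.le ha1 l0 lM l1
  have gmean : ∑ h ∈ Finset.range (9 + 1), (h : ℝ) * gate TH[γ₁, γ₂, γ₃] a h = a * (3 + 2 * γ₁ + 2 * γ₂ + 2 * γ₃) := by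
    rw [sum_mul_gate, lmean]
  set T : ℝ := a * (3 + 2 * γ₁ + 2 * γ₂ + 2 * γ₃) with hT
  have hax0 : 0 < a * x := mul_pos ha0 hx0
  have haxx : a * x ≤ x := by
    have := mul_le_mul_of_nonneg_right ha1 hx0.le
    linarith
  have hax1 : a * x < 1 := by linarith
  have hT0 : 0 < T := by rw [hT]; positivity
  have hTle : T ≤ 3 + 2 * γ₁ + 2 * γ₂ + 2 * γ₃ := by
    have := mul_le_mul_of_nonneg_right ha1 (show (0 : ℝ) ≤ 3 + 2 * γ₁ + 2 * γ₂ + 2 * γ₃ by linarith)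
    linarith
  have hT9 : T < 9 := by linarith
  have hta : a * x * ((9 : ℕ) : ℝ) ≤ T := by
    have := mul_le_mul_of_nonneg_left h9x ha0.le
    push_cast; linarith
  have v1 : gate TH[γ₁, γ₂, γ₃] a 1 = 0 := by rw [gate_apply]; norm_num
  have v2 : gate TH[γ₁, γ₂, γ₃] a 2 = 0 := by rw [gate_apply]; norm_num
  have v3 : gate TH[γ₁, γ₂, γ₃] a 3 = a * ((1 - γ₁) * (1 - γ₂) * (1 - γ₃)) := by rw [gate_apply]; norm_num
  have v4 : gate TH[γ₁, γ₂, γ₃] a 4 = 0 := by rw [gate_apply]; norm_num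
  have v5 : gate TH[γ₁, γ₂, γ₃] a 5 = a * (γ₁ * (1 - γ₂) * (1 - γ₃) + (1 - γ₁) * γ₂ * (1 - γ₃) + (1 - γ₁) * (1 - γ₂) * γ₃) := by
    rw [gate_apply]; norm_num
  have v7 : gate TH[γ₁, γ₂, γ₃] a 7 = a * (γ₁ * γ₂ * (1 - γ₃) + γ₁ * (1 - γ₂) * γ₃ + (1 - γ₁) * γ₂ * γ₃) := by
    rw [gate_apply]; norm_num
  by_cases hT6 : 6 < T
  · -- one near route `3 → t`, `t = 5` (`T < 7`) or `t = 7` (`T ≥ 7`)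
    obtain ⟨t, ht, htT, hTt, hcapt⟩ : ∃ t : ℕ, (t = 5 ∨ t = 7) ∧ ((t : ℝ) ≤ T) ∧ (T < 3 + (t : ℝ)) ∧
        max (a * x) ((T - 2 * ((3 : ℕ) : ℝ)) / ((t : ℝ) - ((3 : ℕ) : ℝ))) *
          (gate TH[γ₁, γ₂, γ₃] a 3 + gate TH[γ₁, γ₂, γ₃] a t) ≤ gate TH[γ₁, γ₂, γ₃] a t := by
      by_cases hT7 : T < 7
      · refine ⟨5, Or.inl rfl, by push_cast; linarith, by push_cast; linarith, ?_⟩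
        have eθ : (T - 2 * ((3 : ℕ) : ℝ)) / (((5 : ℕ) : ℝ) - ((3 : ℕ) : ℝ)) = (T - 6) / 2 := by norm_num
        rw [eθ, v3, v5]
        set E₀ := (1 - γ₁) * (1 - γ₂) * (1 - γ₃) with hE₀
        set E₁ := γ₁ * (1 - γ₂) * (1 - γ₃) + (1 - γ₁) * γ₂ * (1 - γ₃) + (1 - γ₁) * (1 - γ₂) * γ₃ with hE₁
        have e0 : 0 ≤ E₀ + E₁ := by linarith
        rcases le_total (a * x) ((T - 6) / 2) with hle | hle
        · rw [max_eq_right hle]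
          have hb : (T - 6) / 2 ≤ 1 / 2 := by linarith
          have h1 := mul_le_mul_of_nonneg_right hb e0
          have h2 : (1 : ℝ) / 2 * (E₀ + E₁) ≤ E₁ := by linarith
          have h3 := mul_le_mul_of_nonneg_left (h1.trans h2) ha0.le
          have e : (T - 6) / 2 * (a * E₀ + a * E₁) = a * ((T - 6) / 2 * (E₀ + E₁)) := by ring
          rw [e]; exact h3
        · rw [max_eq_left hle]
          have h1 := mul_le_mul_of_nonneg_right haxx e0
          have h3 := mul_le_mul_of_nonneg_left (h1.trans key1) ha0.le
          have e : a * x * (a * E₀ + a * E₁) = a * (a * x * (E₀ + E₁)) := by ring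
          rw [e]; exact h3
      · have hT7 : 7 ≤ T := le_of_not_gt hT7
        refine ⟨7, Or.inr rfl, by push_cast; linarith, by push_cast; linarith, ?_⟩
        have eθ : (T - 2 * ((3 : ℕ) : ℝ)) / (((7 : ℕ) : ℝ) - ((3 : ℕ) : ℝ)) = (T - 6) / 4 := by norm_num
        rw [eθ, v3, v7]
        set E₀ := (1 - γ₁) * (1 - γ₂) * (1 - γ₃) with hE₀
        set E₂ := γ₁ * γ₂ * (1 - γ₃) + γ₁ * (1 - γ₂) * γ₃ + (1 - γ₁) * γ₂ * γ₃ with hE₂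
        have e0 : 0 ≤ E₀ + E₂ := by linarith
        rcases le_total (a * x) ((T - 6) / 4) with hle | hle
        · rw [max_eq_right hle]
          have hb : (T - 6) / 4 ≤ 3 / 4 := by linarith
          have h1 := mul_le_mul_of_nonneg_right hb e0
          have h2 : (3 : ℝ) / 4 * (E₀ + E₂) ≤ E₂ := by linarith
          have h3 := mul_le_mul_of_nonneg_left (h1.trans h2) ha0.le
          have e : (T - 6) / 4 * (a * E₀ + a * E₂) = a * ((T - 6) / 4 * (E₀ + E₂)) := by ring
          rw [e]; exact h3
        · rw [max_eq_left hle]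
          have h1 := mul_le_mul_of_nonneg_right haxx e0
          have h3 := mul_le_mul_of_nonneg_left (h1.trans key3) ha0.le
          have e : a * x * (a * E₀ + a * E₂) = a * (a * x * (E₀ + E₂)) := by ring
          rw [e]; exact h3
    have ht3 : (3 : ℕ) ≠ t := by rcases ht with rfl | rfl <;> norm_num
    have ht9 : t ≤ 9 := by rcases ht with rfl | rfl <;> norm_num
    have htmem : t ∈ Finset.range (9 + 1) := Finset.mem_range.2 (by omega)
    have hθ1 : max (a * x) ((T - 2 * ((3 : ℕ) : ℝ)) / ((t : ℝ) - ((3 : ℕ) : ℝ))) < 1 := by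
      refine max_lt hax1 ?_
      rcases ht with rfl | rfl
      · have h8 : T < 8 := by push_cast at hTt; linarith
        rw [show (T - 2 * ((3 : ℕ) : ℝ)) / (((5 : ℕ) : ℝ) - ((3 : ℕ) : ℝ)) = (T - 6) / 2 by norm_num]; linarith
      · rw [show (T - 2 * ((3 : ℕ) : ℝ)) / (((7 : ℕ) : ℝ) - ((3 : ℕ) : ℝ)) = (T - 6) / 4 by norm_num]; linarith
    have row3 : ∑ h ∈ Finset.range (9 + 1), (if 3 = 3 ∧ h = t then gate TH[γ₁, γ₂, γ₃] a 3 else 0) = gate TH[γ₁, γ₂, γ₃] a 3 := by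
      rw [Finset.sum_eq_single_of_mem t htmem (fun h _ hh => by simp [hh])]
      simp
    have rowz : ∀ l : ℕ, l ≠ 3 → ∑ h ∈ Finset.range (9 + 1), (if l = 3 ∧ h = t then gate TH[γ₁, γ₂, γ₃] a 3 else 0) = 0 := by
      intro l hl; exact Finset.sum_eq_zero fun h _ => by simp [hl]
    refine decAt_all_of_budget_near (a * x) 9 9 (gate TH[γ₁, γ₂, γ₃] a)
      (fun l h => if l = 3 ∧ h = t then gate TH[γ₁, γ₂, γ₃] a 3 else 0) T hax0 hax1 g0 gM g1 gmean hT0 hta ?_ ?_ ?_ ?_ ?_ ?_ j' hj'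
    · -- nonnegativity of the transport
      intro l h; split_ifs
      · exact g0 3
      · exact le_rfl
    · -- support of the transport
      intro l h hlh
      split_ifs at hlh with hc
      · obtain ⟨rfl, rfl⟩ := hc
        refine ⟨by norm_num, by push_cast; linarith, by omega, ht9, by push_cast; linarith, htT⟩
      · exact absurd hlh (lt_irrefl _)
    · -- rows
      intro l
      by_cases hl : l = 3
      · subst hl; rw [row3]
      · rw [rowz l hl]; exact g0 l
    · -- capacities
      intro h
      by_cases hh : h = t
      · subst hh
        rw [Finset.sum_eq_single_of_mem 3 (by simp) (fun l _ hl => by simp [hl])]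
        simp only [true_and, if_true]
        exact rate_mul_le_of_theta hθ1 hcapt (g0 3)
      · rw [Finset.sum_eq_zero (fun l _ => by simp [hh])]
        exact g0 h
    · -- no leftover
      intro l hl hlow hlt
      exfalso
      have hl5 : l < 5 := by
        have : (l : ℝ) < 5 := by
          have : (2 : ℝ) * l < 9 := lt_trans hlow hT9
          linarith
        exact_mod_cast this
      interval_cases l
      · rw [v1, rowz 1 (by norm_num)] at hlt; exact lt_irrefl _ hlt
      · rw [v2, rowz 2 (by norm_num)] at hlt; exact lt_irrefl _ hlt
      · rw [row3] at hlt; exact lt_irrefl _ hlt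
      · rw [v4, rowz 4 (by norm_num)] at hlt; exact lt_irrefl _ hlt
    · -- budget: nothing is owed
      have hL : ∑ l ∈ Finset.range (9 + 1), (if (1 ≤ l ∧ 2 * (l : ℝ) < T) then
          (gate TH[γ₁, γ₂, γ₃] a l - ∑ h ∈ Finset.range (9 + 1), (if l = 3 ∧ h = t then gate TH[γ₁, γ₂, γ₃] a 3 else 0)) * (T - l)
          else 0) = 0 := by
        refine Finset.sum_eq_zero fun l _ => ?_
        split_ifs with hc
        · have hl5 : l < 5 := by
            have : (l : ℝ) < 5 := by
              have : (2 : ℝ) * l < 9 := lt_trans hc.2 hT9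
              linarith
            exact_mod_cast this
          have hl1 := hc.1
          interval_cases l
          · rw [v1, rowz 1 (by norm_num)]; ring
          · rw [v2, rowz 2 (by norm_num)]; ring
          · rw [row3]; ring
          · rw [v4, rowz 4 (by norm_num)]; ring
        · rfl
      rw [hL]
      exact Finset.sum_nonneg fun h _ => by
        split_ifs with hc
        · exact mul_nonneg (g0 h) (by linarith [hc.1])
        · exact le_rfl
  · -- no positive low atom
    refine decAt_all_of_lowCeiling (a * x) 9 (gate TH[γ₁, γ₂, γ₃] a) T hax0 hax1 g0 gM g1 gmean hT0 hta ?_ j' hj'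
    intro l hl hlow hpos
    exfalso
    have hl3 : l < 3 := by
      have : (l : ℝ) < 3 := by linarith
      exact_mod_cast this
    interval_cases l
    · rw [v1] at hpos; exact lt_irrefl _ hpos
    · rw [v2] at hpos; exact lt_irrefl _ hpos


/-! ### Readings for glued children `R[q](R²[g])` (`m = q(1+2g) ≥ 2`, floor `x ≤ q·g`; `γ = (m−1)/2`) -/

/-- **THREE GLUED CHILDREN: the sub-floor core `C(γ₁) ∗ C(γ₂) ∗ C(γ₃)` of the piece expansion is SDEC at every floor `x ≤ min qᵢgᵢ`**
(`mᵢ = qᵢ(1+2gᵢ) ≥ 2`) — the all-far-giant term of the new minimal open instance of the sibling step. [this work] -/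
theorem sdec_tripleHub_glued {x q₁ g₁ q₂ g₂ q₃ g₃ : ℝ} (hx0 : 0 < x) (hq₁ : 0 < q₁) (hq₁' : q₁ < 1) (hg₁ : 0 < g₁) (hg₁' : g₁ < 1)
    (hq₂ : 0 < q₂) (hq₂' : q₂ < 1) (hg₂ : 0 < g₂) (hg₂' : g₂ < 1) (hq₃ : 0 < q₃) (hq₃' : q₃ < 1) (hg₃ : 0 < g₃) (hg₃' : g₃ < 1)
    (hm₁ : 2 ≤ q₁ * (1 + 2 * g₁)) (hm₂ : 2 ≤ q₂ * (1 + 2 * g₂)) (hm₃ : 2 ≤ q₃ * (1 + 2 * g₃))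
    (hx₁ : x ≤ q₁ * g₁) (hx₂ : x ≤ q₂ * g₂) (hx₃ : x ≤ q₃ * g₃) :
    SDEC x 9 (lconv 6 3 (lconv 3 3 CP[(q₁ * (1 + 2 * g₁) - 1) / 2] CP[(q₂ * (1 + 2 * g₂) - 1) / 2]) CP[(q₃ * (1 + 2 * g₃) - 1) / 2]) := by
  obtain ⟨a1, a2, a3, a4⟩ := gluedChild_piece_facts hq₁ hq₁' hg₁ hg₁' hm₁ hx₁
  obtain ⟨b1, b2, b3, _⟩ := gluedChild_piece_facts hq₂ hq₂' hg₂ hg₂' hm₂ hx₂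
  obtain ⟨c1, c2, c3, _⟩ := gluedChild_piece_facts hq₃ hq₃' hg₃ hg₃' hm₃ hx₃
  rw [pairHub_eq_lconv, tripleHub_eq_lconv]
  exact sdec_tripleHub hx0 a4 a1 a2 b1 b2 c1 c2 a3 b3 c3

end LawDec
end Quant
end Summit.CriticalPhenomena.PercolationContinuityZ3.Theorems
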